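import Summits.ABC.IUTFork.Cor312PilotIdelesM
import Summits.ABC.IUTFork.Cor312PilotIdelesMRead
import Summits.ABC.IUTFork.Cor312NotLicencePrVolSharpExplicit
import HarnessLib

/-!
# [IUTchIII] Cor. 3.12, Step (xi-f) `Licence` at the SUMMAND-ROUTE M-LEVEL sharp setting `settingPrVolSharpM`
# (carriers `K_{v̲}`, `v̲ ∈ V̲`) — the lattice criterion, the EXPLICIT depth threshold, and the genuine-idele form

PROOF-ONLY record file (D-0012; no definitions, no `Prop` facts) of the abc-iut cell (WAVE-5 discharge seat
abc-iut-w5-d166, gen 5 — the G1-Θ lineage; unit «DEEP-M», offered by abc-iut-w5-d205 2026-08-26T11:27Z). TAKES NO SIDE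
on [IUTchIII] Cor. 3.12.

CONTEXT. The kernel refutation-for-cause of the hull-level clause S_H at DEEP data — abc-iut-w5-d107's
`Real.not_licence_settingPrVolSharp_of_latticeBound` / `…_of_explicit` / `…_of_realises_explicit` (p436396 / p437756) and the
branch-C record `Conditional.not_hSH_v6K_of_exists_deep` (abc-iut-C-cert-1, p438886) — lives at abc-iut-c312-7's F/K-LEVEL
assembled setting `Real.settingPrVolSharp X …`. The branch-C line at the M LEVEL (`Conditional.abc_of_SH_v8M` p440003,
`abc_of_SH_v9M` p441598, `abc_of_SH_v10M` p442072: carriers the completions `K_{v̲}` at the section places `v̲ ∈ V̲ ≅ V_mod` of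
[IUTchI] Def. 3.1 (e)) reads S_H at abc-iut-s2-p8's PARALLEL construction `Real.settingPrVolSharpM D …` (`Cor312PilotIdelesM`,
p438078), which is not an instance of `settingPrVolSharp`. THIS FILE is the M-level twin of the three w5-d107 theorems, by the
same lattice algebra (abc-iut-c312-5 `PadicPresentation.family_image_latticePkS_of_symm` — generic over presentations — at
abc-iut-w5-d166's M-level presentation `presAtM D hlog u`) and the same explicit chain of [IUTchIV] Prop. 1.2 (campaign-S
`iota_smul_normalizedPacket_subset_zpow_smul_logPacket`, `ppow_smul_logPacket_subset`):

* §1 `not_licence_settingPrVolSharpM_of_latticeBound` — at a finite place `u` of `ℚ` (prime `p_u`), a label `j = i+1` and a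
  CAPSULE-SYMMETRIC scalar function `c` on the summands `v⃗` with `ι_j(t_{Θ,j,v̲_j})·(R_I)^∼ ⊆ c(v⃗)·I_{v⃗}`: a polydisc `λ·𝒪_L`
  containing every `ψ_{v⃗}(c(v⃗)·I_{v⃗})` with ONE radius `< ‖t_{q,v⃗₀(j)}‖` refutes `Licence` (the Θ-hull at `(j, u)` lies in
  the (Ind1)/(Ind2)-stable lattice's polydisc hull, which misses a point of the q-pilot region);
* §2 `not_licence_settingPrVolSharpM_of_explicit` — with `K₀ := K_{v̲(x₀)}`, `e = e(K₀/ℚ_p)`, `d = differentOrd`,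
  `a = logRadiusA p e`, `b = logRadiusB p e`: `p^{(j+1)(d+a+b)+1}·‖t_{Θ,j,x₀}‖ < ‖t_{q,x₀}‖ ⟹ ¬ Licence` (constant tuple
  `(x₀,…,x₀)`, scalar function `v⃗ ↦ p^{⌊min_a λ(v⃗_a) − d_{I_{v⃗}} − a_{I_{v⃗}}⌋}·(2p)^{j+1}`, radii `ψ_{v⃗}(p^{N(v⃗)}·⊗h)`);
* §3 the GENUINE ideles of a Θ-volume datum (abc-iut-w5-d033's read-off `tThetaM` / `tqM` of idele data `r`, p436273):
  `‖t_{Θ,i+1,v̲}‖ = ‖t_{q,v̲}‖^{(i+1)²}` (`norm_tThetaM_eq_norm_tqM_pow`, Dupuy–Hilado (3.4) with `P_{Θ,j} = j²·P_q`), hence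
  **`not_licence_settingPrVolSharpM_tThetaM_of_explicit_depth`**: `p^{(j+1)(d+a+b)+1}·‖t_{q,x₀}‖^{j²−1} < 1 ⟹ ¬ Licence`
  at the summand-route M-level sharp setting of the datum's OWN ideles — in orders «`(j²−1)·ord_p(t_{q,x₀}) > (j+1)(d+a+b)+1`».

READING (neutral, numbers not adjectives). Exactly as at the F/K level: an EFFECTIVE case-A region in the SHARP reading
(Θ-possible-image set constant in `m`, typed (Ind1)/(Ind2) = Dupuy–Hilado families); below the threshold NOTHING is claimed;
nothing about the printed GLOBAL inequality, the NUMBER-level Corollary (`Cor22.Cor312AtDatum`) or any author's intended hull.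
The branch-C record at the M line (`¬ hSH` of `abc_of_SH_v10M` given one deep admissible datum) is the companion
`Conditional/AbcOfSGenuineMShrinkDepth`. [claim: Mochizuki2012, status: disputed] for [IUTchIII] Cor. 3.12 Step (xi-f);
[cite: Mochizuki2012, IUTchIV Prop. 1.2 (i)(ii) p. 10–11; IUTchI Def. 3.1 (e) p. 62]; [cite: DupuyHilado2025, §3.4, §3.9,
§4.7, §4.9, §4.10]; [cite: ScholzeStix2018, §2.2 pp. 9–10]. HONEST FRAMING: nothing here asserts that abc or [IUTchIII]
Cor. 3.12 is proved or refuted; «refuted as typed» ≠ «refuted in print»; typed ≠ proved; instantiated ≠ endorsed.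
-/

noncomputable section

open Set Function NumberField IsDedekindDomain
open scoped Pointwise

namespace Summit.ABC.IUTFork.Thm311.Real

open Cor312 Cor312Vol Literature.IUT.LogThetaLattice Literature.IUT.LogVolume Literature.IUT.HodgeTheaters
  Literature.NumberTheory.NumberFields

variable {F K Fbar : Type} [Field F] [NumberField F] [Field K] [NumberField K] [Algebra F K]
  [Field Fbar] [Algebra F Fbar] [Algebra K Fbar] {E : WeierstrassCurve F} [E.IsElliptic] {l : ℕ}
  {Pb : BadPlacePredicates K} (D : InitialThetaData F K Fbar E l Pb) {logvK : PadicLogsVal K}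
  (hlog : LogvAnalyticVal logvK)
  (t : ∀ (u : FinitePlace ℚ) (_ : Fin (thetaIndexOfInitial D).lstar) (x : (thetaIndexOfInitial D).Fibre (Val.non u)),
    kOfM D (ratChar u) u (natCast_ratChar_mem u) x)
  (tq : ∀ (u : FinitePlace ℚ) (x : (thetaIndexOfInitial D).Fibre (Val.non u)),
    kOfM D (ratChar u) u (natCast_ratChar_mem u) x)
  (M : Type) [Field M] [NumberField M]
  (archPk : ∀ (j : (thetaIndexOfInitial D).Label) (vQ : (thetaIndexOfInitial D).VQ),
    Set ((logShellsOfInitialDH D logvK).Packet j vQ))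
  (archSub : ∀ (j : (thetaIndexOfInitial D).Label) (v : (thetaIndexOfInitial D).V),
    Set ((logShellsOfInitialDH D logvK).Packet j ((thetaIndexOfInitial D).over v)))
  (Ψ : ℤ → ∀ v : (thetaIndexOfInitial D).V, v ∈ (thetaIndexOfInitial D).Vbad →
    Set ((logShellsOfInitialDH D logvK).StarPacket v))
  (act : ℤ → ∀ v : (thetaIndexOfInitial D).V, v ∈ (thetaIndexOfInitial D).Vbad →
    (logShellsOfInitialDH D logvK).StarPacket v → Module.End ℚ ((logShellsOfInitialDH D logvK).StarPacket v))
  (Mmod : ℤ → ∀ j : (thetaIndexOfInitial D).LabelStar, Set ((logShellsOfInitialDH D logvK).GlobalPacket j.1))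
  (region : ℤ → ∀ j : (thetaIndexOfInitial D).LabelStar, FinDivisor M → ∀ vQ : (thetaIndexOfInitial D).VQ,
    Set ((logShellsOfInitialDH D logvK).Packet j.1 vQ))
  (n : ℤ) {HT : Type} {LogLink : HT → HT → Type} {IsFull : ∀ {s t : HT}, LogLink s t → Prop}
  (lat : LGPGaussianLogThetaLattice LogLink IsFull)
  {Frd : Type} {IsoF : Frd → Frd → Type} {Ob : Frd → Type} {realify : Frd → Frd} {Strip : Type}
  {IsoS : Strip → Strip → Type}
  {Mv : ∀ v : (thetaIndexOfInitial D).V, v ∈ (thetaIndexOfInitial D).Vbad → Type} [∀ v h, Monoid (Mv v h)]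
  (sig : GlobalLGPFrobenioidSignature (thetaIndexOfInitial D).lstar (thetaIndexOfInitial D).V
    (· ∈ (thetaIndexOfInitial D).Vbad) Frd IsoF Ob realify Strip IsoS Mv)
  (split : SplittingMonoids Mv) {ObΔ : Type}
  {N : ∀ v : (thetaIndexOfInitial D).V, v ∈ (thetaIndexOfInitial D).Vbad → Type} [∀ v h, Monoid (N v h)]
  (qData : QPilotData ObΔ N)
  (htq0 : ∀ u x, tq u x ≠ 0) (Sq : Finset (FinitePlace ℚ))
  (htq1 : ∀ (u : FinitePlace ℚ) (x : (thetaIndexOfInitial D).Fibre (Val.non u)), u ∉ Sq → ‖tq u x‖ = 1)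

/-! ## §1. The lattice criterion at `settingPrVolSharpM` -/

/-- **`¬ Licence` at the summand-route M-level sharp setting from a summand-wise scaled log-shell lattice thinner than the
q-box.** At a finite place `u` of `ℚ`, a label `j = i+1`, a CAPSULE-SYMMETRIC scalar function `c` with
`ι_j(t_{Θ,j,v̲_j})·(R_I)^∼ ⊆ c(v⃗)·I_{v⃗}` at every summand `v⃗`, and nonzero radii `λ` with `ψ_{v⃗}(c(v⃗)·I_{v⃗}) ⊆ Π_i ‖·‖ ≤ ‖λ_{v⃗,i}‖`:
if at ONE factor `(v⃗₀, i₀)` the radius is `< ‖t_{q,v⃗₀(j)}‖`, then Step (xi-f)'s licence FAILS — the Θ-hull at `(j, u)` lies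
in `e⁻¹(λ·𝒪_L)` (the lattice is fixed by the whole indeterminacy group, abc-iut-c312-5 `family_image_latticePkS_of_symm` at
`presAtM D hlog u`), which misses the point `e⁻¹((ι_j(t_{q,v̲_j}))_{v⃗})` of the q-pilot region. M-level twin of abc-iut-w5-d107's
`not_licence_settingPrVolSharp_of_latticeBound`. [claim: Mochizuki2012, status: disputed] -/
theorem not_licence_settingPrVolSharpM_of_latticeBound (u : FinitePlace ℚ) (i : Fin (thetaIndexOfInitial D).lstar)
    (c : ((thetaIndexOfInitial D).Caps (Setting.labelSucc i) → (thetaIndexOfInitial D).Fibre (Val.non u)) →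
      ℚ_[ratChar u])
    (hc : ∀ (σ : Equiv.Perm ((thetaIndexOfInitial D).Caps (Setting.labelSucc i))) e, c (e ∘ ⇑σ) = c e)
    (hbox : ∀ e, sharpBoxM D hlog t u (Setting.labelSucc i) e ⊆ c e • logShell (ratChar u) ((presAtM D hlog u).kk e))
    (r : ∀ s : factorIdxM D hlog (Setting.labelSucc i) (Val.non u), factorFieldM D hlog (Setting.labelSucc i) (Val.non u) s)
    (hr0 : ∀ s, r s ≠ 0)
    (hr : ∀ e, ∀ y ∈ c e • logShell (ratChar u) ((presAtM D hlog u).kk e),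
      ∀ i', ‖dEquiv (ratChar u) ((presAtM D hlog u).kk e) y i'‖ ≤ ‖r ⟨e, i'⟩‖)
    (e₀ : (thetaIndexOfInitial D).Caps (Setting.labelSucc i) → (thetaIndexOfInitial D).Fibre (Val.non u))
    (i₀ : DIdx (ratChar u) ((presAtM D hlog u).kk e₀))
    (hlt : ‖r ⟨e₀, i₀⟩‖ < ‖tq u (e₀ (Fin.last _))‖) :
    ¬ Thm311ToCor312.Licence
      (settingPrVolSharpM D hlog t tq M archPk archSub Ψ act Mmod region n lat sig split qData htq0 Sq htq1) := by
  set P := settingPrVolSharpM D hlog t tq M archPk archSub Ψ act Mmod region n lat sig split qData htq0 Sq htq1 with hP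
  refine P.not_licence_of_hul_superset i (Val.non u)
    (W := (presAtM D hlog u).latticePkS (Setting.labelSucc i) c)
    (H := factorMapM D hlog (Setting.labelSucc i) (Val.non u) ⁻¹'
      hullSet (factorFieldM D hlog (Setting.labelSucc i) (Val.non u)) r)
    (fun Φ hΦ => (presAtM D hlog u).family_image_latticePkS_of_symm hΦ _ hc) ?_ ?_ ?_ ?_
  · -- the (Ind3)-region = `e⁻¹(Π sharp boxes)` lies in `e⁻¹(Π c·I)`
    intro x hx
    rw [hP, thetaRegion3_settingPrVolSharpM] at hx
    have hx' : x ∈ (fun x => (presAtM D hlog u).factorMap (Setting.labelSucc i) x) ⁻¹'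
        (presAtM D hlog u).boxOf (sharpBoxM D hlog t u (Setting.labelSucc i)) := hx
    rw [(presAtM D hlog u).factorMap_preimage_boxOf] at hx'
    show (presAtM D hlog u).comparison _ x ∈ (presAtM D hlog u).summandLatticeS _ c
    rw [(presAtM D hlog u).mem_summandLatticeS_iff]
    exact fun e => hbox e ((Set.mem_univ_pi.1 hx') e)
  · -- `e⁻¹(λ·𝒪_L)` is a hull-set of the pulled-back real frame
    exact ⟨hullSet _ r, ⟨r, hr0, rfl⟩, rfl⟩
  · -- `e⁻¹(Π c·I) ⊆ e⁻¹(λ·𝒪_L)` by the radius bound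
    intro x hx
    have hx' := ((presAtM D hlog u).mem_summandLatticeS_iff c _).1 hx
    show factorMapM D hlog (Setting.labelSucc i) (Val.non u) x ∈ hullSet _ r
    rw [hullSet, mem_polydisc]
    rintro ⟨e, i'⟩
    exact hr e _ (hx' e) i'
  · -- the q-region contains `e⁻¹((ι_j(t_{q,v̲_j}))_{v⃗})`, whose `(v⃗₀,i₀)`-coordinate has norm `‖t_{q,v⃗₀(j)}‖ > ‖λ_{v⃗₀,i₀}‖`
    intro hsub
    set g : ∀ e : (thetaIndexOfInitial D).Caps (Setting.labelSucc i) → (thetaIndexOfInitial D).Fibre (Val.non u),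
        (presAtM D hlog u).X e :=
      fun e => iota (ratChar u) ((presAtM D hlog u).kk e) (Fin.last _) (tq u (e (Fin.last _))) with hg
    obtain ⟨x, hx⟩ := (presAtM D hlog u).comparison_surjective (Setting.labelSucc i) g
    have hxq : x ∈ P.qRegion (Setting.labelSucc i) (Val.non u) := by
      rw [hP, qRegion_settingPrVolSharpM]
      show x ∈ (fun x => (presAtM D hlog u).factorMap (Setting.labelSucc i) x) ⁻¹'
        hullSet ((presAtM D hlog u).factorField (Setting.labelSucc i)) ((presAtM D hlog u).qCentre (tq u) (Setting.labelSucc i))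
      rw [(presAtM D hlog u).factorMap_preimage_hullSet_qCentre (tq u) (htq0 u)]
      refine Set.mem_preimage.2 ?_
      rw [hx, Set.mem_univ_pi]
      intro e
      show g e ∈ g e • (normalizedPacket (ratChar u) ((presAtM D hlog u).kk e) : Set ((presAtM D hlog u).X e))
      exact Set.mem_smul_set.2
        ⟨1, (normalizedPacket (ratChar u) ((presAtM D hlog u).kk e)).one_mem, by rw [smul_eq_mul, mul_one]⟩
    have hxH := hsub hxq
    have hle : ‖factorMapM D hlog (Setting.labelSucc i) (Val.non u) x ⟨e₀, i₀⟩‖ ≤ ‖r ⟨e₀, i₀⟩‖ := by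
      have h := hxH
      change factorMapM D hlog (Setting.labelSucc i) (Val.non u) x ∈ hullSet _ r at h
      rw [hullSet, mem_polydisc] at h
      exact h ⟨e₀, i₀⟩
    have heq : ‖factorMapM D hlog (Setting.labelSucc i) (Val.non u) x ⟨e₀, i₀⟩‖ = ‖tq u (e₀ (Fin.last _))‖ := by
      show ‖dEquiv (ratChar u) ((presAtM D hlog u).kk e₀) ((presAtM D hlog u).comparison _ x e₀) i₀‖ = _
      rw [hx, hg]
      exact norm_dEquiv_iota (ratChar u) _ (Fin.last _) _ i₀
    exact absurd (heq ▸ hle) (not_le.2 hlt)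

/-- Plumbing: a minimum over the capsule is unchanged by re-indexing the tuple with a permutation. [folklore] -/
private theorem inf'_comp_perm_M {ι α : Type} [Fintype ι] [Nonempty ι] (f : α → ℝ) (e : ι → α) (σ : Equiv.Perm ι) :
    Finset.univ.inf' Finset.univ_nonempty (fun a => f (e (σ a))) =
      Finset.univ.inf' Finset.univ_nonempty (fun a => f (e a)) := by
  apply le_antisymm
  · refine Finset.le_inf' _ _ fun a _ => ?_
    have h := Finset.inf'_le (fun a => f (e (σ a))) (Finset.mem_univ (σ.symm a))
    simpa using h
  · exact Finset.le_inf' _ _ fun a _ => Finset.inf'_le (fun a => f (e a)) (Finset.mem_univ (σ a))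

/-! ## §2. The explicit threshold -/

/-- **`¬ Licence` at `settingPrVolSharpM` with an EXPLICIT threshold in the constants of [IUTchIV] Prop. 1.2.** For nonzero
Θ-ideles, a finite place `u` of `ℚ` (prime `p = p_u`), a label `j = i+1` and a point `x₀` of the fibre `V̲_u`, writing
`K₀ = K_{v̲(x₀)}`, `e = e(K₀/ℚ_p)`, `d = differentOrd`, `a = logRadiusA p e`, `b = logRadiusB p e`: if
`p^{(j+1)(d+a+b)+1}·‖t_{Θ,j,x₀}‖ < ‖t_{q,x₀}‖` then Step (xi-f)'s licence FAILS. M-level twin of abc-iut-w5-d107's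
`not_licence_settingPrVolSharp_of_explicit` (same proof at the presentation `presAtM D hlog u`).
[claim: Mochizuki2012, status: disputed] -/
theorem not_licence_settingPrVolSharpM_of_explicit (ht0 : ∀ u i x, t u i x ≠ 0) (u : FinitePlace ℚ)
    (i : Fin (thetaIndexOfInitial D).lstar) (x₀ : (thetaIndexOfInitial D).Fibre (Val.non u))
    (hdeep : ((ratChar u : ℕ) : ℝ) ^ ((((i : ℕ) : ℝ) + 2) *
        (differentOrd (ratChar u) (kOfM D (ratChar u) u (natCast_ratChar_mem u) x₀)
          + logRadiusA (ratChar u) (absRamificationIdx (ratChar u) (kOfM D (ratChar u) u (natCast_ratChar_mem u) x₀))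
          + logRadiusB (ratChar u) (absRamificationIdx (ratChar u) (kOfM D (ratChar u) u (natCast_ratChar_mem u) x₀))) + 1) *
        ‖t u i x₀‖ < ‖tq u x₀‖) :
    ¬ Thm311ToCor312.Licence
      (settingPrVolSharpM D hlog t tq M archPk archSub Ψ act Mmod region n lat sig split qData htq0 Sq htq1) := by
  classical
  haveI hne : Nonempty ((thetaIndexOfInitial D).Caps (Setting.labelSucc i)) := ⟨0⟩
  set p : ℕ := ratChar u with hpdef
  set P := presAtM D hlog u with hPdef
  set j := Setting.labelSucc (T := thetaIndexOfInitial D) i with hj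
  have hp0 : (0 : ℝ) < (p : ℕ) := by exact_mod_cast (Fact.out : p.Prime).pos
  have hp1 : (1 : ℝ) ≤ (p : ℕ) := by exact_mod_cast (Fact.out : p.Prime).one_lt.le
  have hI : 2 ≤ Fintype.card ((thetaIndexOfInitial D).Caps j) := two_le_card_caps_labelSucc_M D i
  -- orders of the label ideles: `‖t_{Θ,j,x}‖ = p^{−λ(x)}`, `λ(x) = mx(x)/e(x)`
  have hmx : ∀ x : (thetaIndexOfInitial D).Fibre (Val.non u), ∃ m : ℤ,
      ‖labelIdeleM D t u j x‖ =
        ((p : ℕ) : ℝ) ^ (-((m : ℝ) / absRamificationIdx p (kOfM D (ratChar u) u (natCast_ratChar_mem u) x))) :=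
    fun x => exists_norm_eq_rpow p _ (labelIdeleM_ne_zero D t ht0 u j x)
  choose mx hmx using hmx
  set lam : (thetaIndexOfInitial D).Fibre (Val.non u) → ℝ := fun x =>
    (mx x : ℝ) / absRamificationIdx p (kOfM D (ratChar u) u (natCast_ratChar_mem u) x) with hlam
  -- the symmetric exponent `N(v⃗) = ⌊min_a λ(v⃗_a) − d_I − a_I⌋` and scalar function `c(v⃗) = p^{N(v⃗)}·s⁻¹`
  set Nf : ((thetaIndexOfInitial D).Caps j → (thetaIndexOfInitial D).Fibre (Val.non u)) → ℤ := fun e =>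
    ⌊Finset.univ.inf' Finset.univ_nonempty (fun a => lam (e a)) - dSum p (P.kk e) - aSum p (P.kk e)⌋ with hNf
  set s : ℚ_[p] := shellScalar p (I := (thetaIndexOfInitial D).Caps j) with hs
  have hs0 : s ≠ 0 := shellScalar_ne_zero p
  -- realisations of `p^{−b_I}` per summand
  have hh : ∀ e : (thetaIndexOfInitial D).Caps j → (thetaIndexOfInitial D).Fibre (Val.non u),
      ∃ h : ∀ a, P.kk e a, RealizesNegB p (P.kk e) h :=
    fun e => exists_realizesNegB p (P.kk e)
  choose h hh using hh
  -- symmetry of `Nf`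
  have hdSum : ∀ (σ : Equiv.Perm ((thetaIndexOfInitial D).Caps j)) e, dSum p (P.kk (e ∘ ⇑σ)) = dSum p (P.kk e) :=
    fun σ e => Equiv.sum_comp σ (fun a => differentOrd p (P.kk e a))
  have haSum : ∀ (σ : Equiv.Perm ((thetaIndexOfInitial D).Caps j)) e, aSum p (P.kk (e ∘ ⇑σ)) = aSum p (P.kk e) :=
    fun σ e => Equiv.sum_comp σ (fun a => logRadiusA p (absRamificationIdx p (P.kk e a)))
  have hNsymm : ∀ (σ : Equiv.Perm ((thetaIndexOfInitial D).Caps j)) e, Nf (e ∘ ⇑σ) = Nf e := by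
    intro σ e
    show ⌊Finset.univ.inf' Finset.univ_nonempty (fun a => lam (e (σ a))) - _ - _⌋ = ⌊_ - _ - _⌋
    rw [inf'_comp_perm_M lam e σ, hdSum σ e, haSum σ e]
  -- `c(v⃗)·I_{v⃗} = p^{N(v⃗)}·log_p(R^×_{v⃗})`
  have hcI : ∀ e, ((((p : ℕ) : ℚ_[p]) ^ Nf e * s⁻¹) • logShell p (P.kk e)) =
      (((p : ℕ) : ℚ_[p]) ^ Nf e) • (logPacket p (P.kk e) : Set (P.X e)) := by
    intro e
    show _ • (shellScalar p (I := (thetaIndexOfInitial D).Caps j) • (logPacket p (P.kk e) : Set (P.X e))) = _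
    rw [smul_smul, ← hs, inv_mul_cancel_right₀ hs0]
  refine not_licence_settingPrVolSharpM_of_latticeBound D hlog t tq M archPk archSub Ψ act Mmod region n lat sig split qData
    htq0 Sq htq1 u i (fun e => ((p : ℕ) : ℚ_[p]) ^ Nf e * s⁻¹)
    (fun σ e => by show ((p : ℕ) : ℚ_[p]) ^ Nf (e ∘ ⇑σ) * s⁻¹ = _; rw [hNsymm σ e]) ?_
    (fun z => dEquiv p (P.kk z.1) (ppow p (P.kk z.1) (Nf z.1) * purePacket p (P.kk z.1) (h z.1)) z.2)
    (fun z => dEquiv_ppow_mul_purePacket_ne_zero p (P.kk z.1) (Nf z.1) (ne_zero_of_realizesNegB p (P.kk z.1) (hh z.1)) z.2)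
    ?_ (fun _ => x₀) (Classical.choice (inferInstance : Nonempty (DIdx p (P.kk fun _ => x₀)))) ?_
  · -- the sharp boxes lie in `p^{N(v⃗)}·log_p(R^×_{v⃗})`: Prop. 1.2 (ii) at the identity + monotonicity in the exponent
    intro e
    rw [hcI e]
    have h1 := iota_smul_normalizedPacket_subset_zpow_smul_logPacket p (P.kk e) hI (i := Fin.last _)
      (m := mx (e (Fin.last _))) (g := labelIdeleM D t u j (e (Fin.last _))) (hmx (e (Fin.last _)))
    refine h1.trans (zpow_smul_logPacket_anti p (P.kk e) (Int.floor_le_floor ?_))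
    have hmin : Finset.univ.inf' Finset.univ_nonempty (fun a => lam (e a)) ≤ lam (e (Fin.last _)) :=
      Finset.inf'_le _ (Finset.mem_univ _)
    show _ - dSum p (P.kk e) - aSum p (P.kk e) ≤
      (mx (e (Fin.last _)) : ℝ) / absRamificationIdx p (P.kk e (Fin.last _)) - dSum p (P.kk e) - aSum p (P.kk e)
    have : lam (e (Fin.last _)) = (mx (e (Fin.last _)) : ℝ) / absRamificationIdx p (P.kk e (Fin.last _)) := rfl
    linarith
  · -- the radii `ψ_{v⃗}(p^{N(v⃗)}·⊗h)` bound the coordinates of `p^{N(v⃗)}·log_p(R^×_{v⃗})`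
    intro e y hy i'
    rw [hcI e] at hy
    exact norm_dEquiv_le_of_mem_zpow_smul_logPacket p (P.kk e) (hh e) (Nf e) hy i'
  · -- at the constant tuple the radius is `p^{−N₀}·p^{(j+1)b} ≤ p^{(j+1)(d+a+b)+1}·‖t_{Θ,j,x₀}‖ < ‖t_{q,x₀}‖`
    set e₀ : (thetaIndexOfInitial D).Caps j → (thetaIndexOfInitial D).Fibre (Val.non u) := fun _ => x₀ with he₀
    set i₀ := Classical.choice (inferInstance : Nonempty (DIdx p (P.kk e₀))) with hi₀
    show ‖dEquiv p (P.kk e₀) (ppow p (P.kk e₀) (Nf e₀) * purePacket p (P.kk e₀) (h e₀)) i₀‖ < ‖tq u (e₀ (Fin.last _))‖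
    rw [norm_dEquiv_ppow_mul_purePacket p (P.kk e₀) (hh e₀)]
    -- the constants at the constant tuple
    set K₀ := kOfM D (ratChar u) u (natCast_ratChar_mem u) x₀ with hK₀
    set dK : ℝ := differentOrd p K₀ with hdK
    set aK : ℝ := logRadiusA p (absRamificationIdx p K₀) with haK
    set bK : ℝ := logRadiusB p (absRamificationIdx p K₀) with hbK
    have hcard : (Fintype.card ((thetaIndexOfInitial D).Caps j) : ℝ) = ((i : ℕ) : ℝ) + 2 := by
      rw [show Fintype.card ((thetaIndexOfInitial D).Caps j) = (j : ℕ) + 1 from Fintype.card_fin _, hj, Setting.labelSucc,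
        Fin.val_succ]
      push_cast
      ring
    have hd0 : dSum p (P.kk e₀) = (((i : ℕ) : ℝ) + 2) * dK := by
      show ∑ _a : (thetaIndexOfInitial D).Caps j, differentOrd p K₀ = _
      rw [Finset.sum_const, Finset.card_univ, nsmul_eq_mul, hcard]
    have ha0 : aSum p (P.kk e₀) = (((i : ℕ) : ℝ) + 2) * aK := by
      show ∑ _a : (thetaIndexOfInitial D).Caps j, logRadiusA p (absRamificationIdx p K₀) = _
      rw [Finset.sum_const, Finset.card_univ, nsmul_eq_mul, hcard]
    have hb0 : bSum p (P.kk e₀) = (((i : ℕ) : ℝ) + 2) * bK := by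
      show ∑ _a : (thetaIndexOfInitial D).Caps j, logRadiusB p (absRamificationIdx p K₀) = _
      rw [Finset.sum_const, Finset.card_univ, nsmul_eq_mul, hcard]
    have hinf : Finset.univ.inf' Finset.univ_nonempty (fun a : (thetaIndexOfInitial D).Caps j => lam (e₀ a)) = lam x₀ :=
      le_antisymm (Finset.inf'_le _ (Finset.mem_univ (0 : (thetaIndexOfInitial D).Caps j)))
        (Finset.le_inf' _ _ fun _ _ => le_rfl)
    have hNf0 : Nf e₀ = ⌊lam x₀ - (((i : ℕ) : ℝ) + 2) * dK - (((i : ℕ) : ℝ) + 2) * aK⌋ := by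
      show ⌊Finset.univ.inf' Finset.univ_nonempty (fun a => lam (e₀ a)) - dSum p (P.kk e₀) - aSum p (P.kk e₀)⌋ = _
      rw [hinf, hd0, ha0]
    have hN0 : (lam x₀ - (((i : ℕ) : ℝ) + 2) * dK - (((i : ℕ) : ℝ) + 2) * aK : ℝ) < (Nf e₀ : ℝ) + 1 := by
      rw [hNf0]
      exact Int.lt_floor_add_one _
    -- `‖t_{Θ,j,x₀}‖ = p^{−λ(x₀)}`
    have htn : ‖t u i x₀‖ = ((p : ℕ) : ℝ) ^ (-lam x₀) := by
      rw [← labelIdeleM_labelSucc D t u i x₀]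
      exact hmx x₀
    -- compare exponents
    have hexp : ((p : ℕ) : ℝ) ^ (-(Nf e₀) : ℤ) * ((p : ℕ) : ℝ) ^ bSum p (P.kk e₀) ≤
        ((p : ℕ) : ℝ) ^ ((((i : ℕ) : ℝ) + 2) * (dK + aK + bK) + 1) * ‖t u i x₀‖ := by
      rw [htn, ← Real.rpow_intCast, ← Real.rpow_add hp0, ← Real.rpow_add hp0, hb0]
      refine Real.rpow_le_rpow_of_exponent_le hp1 ?_
      push_cast
      linarith
    exact lt_of_le_of_lt hexp hdeep

/-! ## §3. The genuine ideles of a Θ-volume datum: `‖t_Θ‖ = ‖t_q‖^{j²}` and the threshold in orders of `t_q` -/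

section Genuine

variable (r : ThetaData.IdeleData D)

/-- **`‖t_{Θ,i+1,v̲}‖ = ‖t_{q,v̲}‖^{(i+1)²}` for the read-off ideles of a Θ-volume datum** (abc-iut-w5-d033's Dupuy–Hilado (3.4)
identities `log_norm_tThetaM` / `log_norm_tqM` with `P_{Θ,i+1} = (i+1)²·P_q`, `PilotData.thetaPilot_eq_smul`, exponentiated).
M-level twin of abc-iut-w5-d107's `norm_thetaIdele_eq_pow_of_realises`. [cite: DupuyHilado2025, §3.3, §3.4] -/
theorem norm_tThetaM_eq_norm_tqM_pow (p : ℕ) [Fact p.Prime] (u : FinitePlace ℚ)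
    (hu : ((p : ℕ) : 𝓞 ℚ) ∈ (FinitePlace.maximalIdeal u).asIdeal)
    (i : Fin (thetaIndexOfInitial D).lstar) (x : (thetaIndexOfInitial D).Fibre (Val.non u)) :
    ‖tThetaM D p u hu r i x‖ = ‖tqM D p u hu r x‖ ^ (((i : ℕ) + 1) ^ 2) := by
  have hq0 : 0 < ‖tqM D p u hu r x‖ := norm_pos_iff.mpr (tqM_ne_zero D p u hu r x)
  have ht0' : 0 < ‖tThetaM D p u hu r i x‖ := norm_pos_iff.mpr (tThetaM_ne_zero D p u hu r i x)
  refine Real.log_injOn_pos ht0' (pow_pos hq0 _) ?_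
  rw [Real.log_pow, log_norm_tThetaM, log_norm_tqM, PilotData.thetaPilot_eq_smul, Finsupp.smul_apply, smul_eq_mul]
  push_cast
  ring

/-- **Explicit case A at the summand-route M-level sharp setting of the datum's OWN ideles.** For idele data `r` of the initial
Θ-data `D`, the setting `settingPrVolSharpM D … (t := tThetaM r) (tq := tqM r) …` (any column, context data, archimedean
structures, `Sq`/`htq1`), a finite place `u` of `ℚ` (prime `p = p_u`), a label `j = i+1` and a point `x₀` of the fibre `V̲_u`
with `K₀ = K_{v̲(x₀)}` and `d, a, b` as above: `p^{(j+1)(d+a+b)+1} · ‖t_{q,x₀}‖^{j²−1} < 1 ⟹ ¬ Licence` — in orders: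
«`(j²−1)·ord_p(t_{q,x₀}) > (j+1)(d+a+b) + 1`». M-level twin of abc-iut-w5-d107's `not_licence_settingPrVolSharp_of_realises_explicit`.
[claim: Mochizuki2012, status: disputed] -/
theorem not_licence_settingPrVolSharpM_tThetaM_of_explicit_depth
    (htq0' : ∀ (u : FinitePlace ℚ) (x : (thetaIndexOfInitial D).Fibre (Val.non u)),
      tqM D (ratChar u) u (natCast_ratChar_mem u) r x ≠ 0)
    (htq1' : ∀ (u : FinitePlace ℚ) (x : (thetaIndexOfInitial D).Fibre (Val.non u)), u ∉ Sq →
      ‖tqM D (ratChar u) u (natCast_ratChar_mem u) r x‖ = 1)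
    (u : FinitePlace ℚ) (i : Fin (thetaIndexOfInitial D).lstar) (x₀ : (thetaIndexOfInitial D).Fibre (Val.non u))
    (hdeep : ((ratChar u : ℕ) : ℝ) ^ ((((i : ℕ) : ℝ) + 2) *
        (differentOrd (ratChar u) (kOfM D (ratChar u) u (natCast_ratChar_mem u) x₀)
          + logRadiusA (ratChar u) (absRamificationIdx (ratChar u) (kOfM D (ratChar u) u (natCast_ratChar_mem u) x₀))
          + logRadiusB (ratChar u) (absRamificationIdx (ratChar u) (kOfM D (ratChar u) u (natCast_ratChar_mem u) x₀))) + 1) *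
        ‖tqM D (ratChar u) u (natCast_ratChar_mem u) r x₀‖ ^ (((i : ℕ) + 1) ^ 2 - 1) < 1) :
    ¬ Thm311ToCor312.Licence
      (settingPrVolSharpM D hlog (fun u i x => tThetaM D (ratChar u) u (natCast_ratChar_mem u) r i x)
        (fun u x => tqM D (ratChar u) u (natCast_ratChar_mem u) r x) M archPk archSub Ψ act Mmod region n lat sig split
        qData htq0' Sq htq1') := by
  refine not_licence_settingPrVolSharpM_of_explicit D hlog (fun u i x => tThetaM D (ratChar u) u (natCast_ratChar_mem u) r i x)
    (fun u x => tqM D (ratChar u) u (natCast_ratChar_mem u) r x) M archPk archSub Ψ act Mmod region n lat sig split qData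
    htq0' Sq htq1' (fun u i x => tThetaM_ne_zero D (ratChar u) u (natCast_ratChar_mem u) r i x) u i x₀ ?_
  have hq0 : 0 < ‖tqM D (ratChar u) u (natCast_ratChar_mem u) r x₀‖ :=
    norm_pos_iff.mpr (tqM_ne_zero D (ratChar u) u (natCast_ratChar_mem u) r x₀)
  have hk : ((i : ℕ) + 1) ^ 2 = (((i : ℕ) + 1) ^ 2 - 1) + 1 := by
    have : 1 ≤ ((i : ℕ) + 1) ^ 2 := Nat.one_le_pow _ _ (Nat.succ_pos _)
    omega
  show _ * ‖tThetaM D (ratChar u) u (natCast_ratChar_mem u) r i x₀‖ < ‖tqM D (ratChar u) u (natCast_ratChar_mem u) r x₀‖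
  rw [norm_tThetaM_eq_norm_tqM_pow D r (ratChar u) u (natCast_ratChar_mem u) i x₀]
  calc _ = (((ratChar u : ℕ) : ℝ) ^ ((((i : ℕ) : ℝ) + 2) *
        (differentOrd (ratChar u) (kOfM D (ratChar u) u (natCast_ratChar_mem u) x₀)
          + logRadiusA (ratChar u) (absRamificationIdx (ratChar u) (kOfM D (ratChar u) u (natCast_ratChar_mem u) x₀))
          + logRadiusB (ratChar u) (absRamificationIdx (ratChar u) (kOfM D (ratChar u) u (natCast_ratChar_mem u) x₀))) + 1) *
        ‖tqM D (ratChar u) u (natCast_ratChar_mem u) r x₀‖ ^ (((i : ℕ) + 1) ^ 2 - 1)) *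
        ‖tqM D (ratChar u) u (natCast_ratChar_mem u) r x₀‖ := by
        conv_lhs => rw [hk, pow_succ]
        ring
    _ < 1 * ‖tqM D (ratChar u) u (natCast_ratChar_mem u) r x₀‖ := mul_lt_mul_of_pos_right hdeep hq0
    _ = ‖tqM D (ratChar u) u (natCast_ratChar_mem u) r x₀‖ := one_mul _

end Genuine

end Summit.ABC.IUTFork.Thm311.Real

end
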